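import Mathlib.Algebra.MvPolynomial.Variables
import Literature.NumberTheory.GaloisRepresentations.GaloisRep
import HarnessLib

/-!
# Cross-regular auxiliary data for a residually `GL₂ × GL₂`-reducible `GL₄`-representation

Definition item `defn-CrossRegularAuxiliary` (typed currency of the line
`cross-regular-annihilator-primes` of crux `ResiduallyYoshidaLifting`, route `Langlands/PhantomRMYoshida`,
stmt-Langlands-13639): the six PROBLEM-AGNOSTIC primitives `Gen`, `CrossRes`, `CrossCongr`, `CrossType`,
`ExactCross`, `HSC` (plus the ×-polynomial `crossPoly`), in the sub-namespace
`Literature.NumberTheory.GaloisRepresentations.CrossRegular`, so that `Theorems/` proposals proving the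
line's stubs can import them.  The route-specific bundles (`Sh`, `Aut`, `DetCond`, `Member`, `QGood`,
`QGoodRes`, `CrossFamily`) stay problem-side.

## The model (Thorne 2016, `GL₂`)

Thorne, *Automorphy of some residually dihedral Galois representations* (Math. Ann. 364, 2016):
* §5.4.4 defines, at a place `v ∤ p` with `q_v ≡ −1 mod p` where `ρ̄` is unramified and `ρ̄(Frob_v)`
  has two DISTINCT eigenvalues `α_v, β_v` with `α_v / β_v = −1` (`= q_v` in `k`), the Steinberg local
  deformation problem `𝒟_v^{St(α_v)}`: Frobenius eigenvalues `{A_v, B_v = q_v A_v}` lifting `α_v, β_v`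
  and inertia acting trivially on `(r(φ_v) − B_v)R²`;
* Prop. 5.20 produces auxiliary places `v` (disjoint from `S`) at which `𝒟_v^{St(α_v)}` is defined
  and `ρ mod λ^{N}` satisfies `ρ_N(Frob_v) = ρ_N(c)` for a fixed element `c` (there: complex
  conjugation) — so `ρ mod λ^N` is an unramified point of the Steinberg condition at `v`;
* Thm. 4.14 / Cor. 4.15 (automorphy by successive approximation): `ρ` is automorphic as soon as for
  every `N` there is a Hecke-algebra map `f : 𝕋_Q → 𝒪/λ^N` of the `Q`-new (Steinberg at `Q`) Hecke
  algebra with `f(T_v) = tr ρ(Frob_v)` for `v ∉ S ∪ Q`.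

## The transposition (`GL₂ × GL₂ ⊂ GL₄`, this file)

For a `p`-adic `ρ : Γ_K → GL₄(ℚ̄_p)` whose reduction is `σ̄ ⊕ σ̄'` (`σ̄, σ̄' : Γ_K → GL₂(k)`), the role
of `c` is played by an EXACT CROSS-REGULAR element `γ` (`ExactCross`): `ρ(γ)` has eigenvalues
`{a, e a, b, e b}`, `e = ε_p(γ)`, `e² a b = 1`, distributed ACROSS the two residual constituents
(`σ̄(γ) ∼ {ā, ē b̄}`, `σ̄'(γ) ∼ {ē ā, b̄}`) and residually generic (`Gen`: the four residual
eigenvalues are pairwise distinct and neither constituent has internal ratio `ē^{±1}`).  By Chebotarev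
one gets places `v` with `ρ(Frob_v) ≡ ρ(γ) mod p^N`: there `e ↦ ε_p(Frob_v) = q_v` (arithmetic
Frobenius), giving the ×-CONGRUENCE `CrossCongr N v ρ a b` (Frobenius polynomial `≡ crossPoly q_v a b =
(X−a)(X−q_v a)(X−b)(X−q_v b) mod p^N`, `q_v² a b = 1`) with CROSS-REGULAR RESIDUAL position
`CrossRes σ̄ σ̄' v ā b̄`.  The Steinberg condition becomes the ×-TYPE `CrossType v r` of a
characteristic-`0` representation (inertia acts through `u` with `(u − 1)² = 0`, Frobenius polynomial
exactly `crossPoly q_v a b`, `q_v² a b = 1`: two `q_v`-ratio pairs `(a, q_v a)`, `(b, q_v b)` paired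
with each other by `x ↦ q_v⁻¹ x⁻¹` — the eigenvalue pattern of a Weil–Deligne parameter of the form
`χ₁ ⊗ sp₂ ⊕ χ₂ ⊗ sp₂`), and
"`f(T_v) = tr ρ(Frob_v) mod λ^N`" becomes the Hecke-algebra-free HECKE-SPAN CONGRUENCE `HSC N ρf ϱ`:
every integral polynomial relation among the Frobenius-polynomial coefficients satisfied by every
member `ρf i` of a family is satisfied by those of `ϱ` modulo `p^N` (equivalently, the `𝒪`-algebra
`𝕋 ⊆ ∏_i 𝒪` generated by the coefficient tuples — the anaemic Hecke algebra acting faithfully on the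
family — admits `𝕋 → 𝒪/p^N` through `ϱ`).

## Conventions / design

* `K` any field, a number field wherever `q_v = v.residueCard` enters; arithmetic Frobenius
  throughout (`HasFrobCharpolyAt`, Mathlib `IsArithFrobAt`), so `ε_p(Frob_v) = q_v`.
* Residual notions (`Gen`, `CrossRes`) over any commutative coefficient ring `k`; `CrossType` over any
  commutative topological coefficient ring `L`; the INTEGRAL notions (`CrossCongr`, `ExactCross`,
  `HSC`) are stated, as the requesting route needs them, for `ℚ̄_p = PadicAlgCl p` with
  `𝒪 = 𝒪[PadicAlgCl p] = Valued.integer (PadicAlgCl p) = ℤ̄_p`, congruences coefficientwise modulo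
  `p^N` in `ℤ̄_p`, and `ε_p = GaloisRep.cyclotomicCharacter K p` pushed along `ℤ_p → ℚ_p → ℚ̄_p`
  (verbatim the route's spelling of its similitude character).
  -- TODO(general form): coefficient field `L ⊇ 𝒪` with congruences modulo an ideal `I ≤ 𝒪`
  -- (Thorne works modulo `λ^N` in the integers of a finite `E/ℚ_p`).
* `CrossType` does not force the monodromy to be non-zero (`u = 1` is allowed): an unramified
  representation with Frobenius polynomial `crossPoly q_v a b`, `q_v² a b = 1`, is of ×-type
  (`CrossType.of_isUnramifiedAt`), exactly as Thorne's `𝒟_v^{St(α_v)}` contains unramified points.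
* `HSC` with an EMPTY family is false for `N ≥ 1` (the constant relation `1 = 0` holds vacuously for
  all members), so no vacuous truth; a member of an almost-everywhere-unramified integral family is
  Hecke-span congruent to it at every depth (`HSC.of_mem`).
* What is NOT here: the existence of such places / families (Chebotarev, level raising — these are
  the line's stubs, problem-side), and the automorphic companion `HasPrincipalLevelFixedForm`
  (a separate item under `Literature/NumberTheory/Automorphic`).

## References

* [Thorne2016] J. A. Thorne, Automorphy of some residually dihedral Galois representations,
  Math. Ann. 364 (2016) 589–648: §5.4.4 (`𝒟_v^{St(α_v)}`), Lemma 5.18, Prop. 5.20 (auxiliary places,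
  `ρ_N(Frob_v) = ρ_N(c)`), Thm. 4.14 and Cor. 4.15 (`f(T_v) = tr ρ(Frob_v) mod λ^N`).
* [BoxerEtAl2021] G. Boxer, F. Calegari, T. Gee, V. Pilloni, Abelian surfaces over totally real fields
  are potentially modular, Publ. IHÉS 134 (2021), §2 (symplectic with similitude `ε⁻¹`: at an
  unramified `v` the eigenvalues pair as `x ↔ q_v⁻¹ x⁻¹`, whence `q_v² a b = 1` for the ×-shape
  `{a, q_v a | b, q_v b}` with `a ↔ q_v b`, `q_v a ↔ b`).
-/

noncomputable section

open Field IsDedekindDomain Polynomial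
open scoped NumberField Valued

namespace Literature.NumberTheory.GaloisRepresentations

namespace CrossRegular

/-! ### Residual genericity of a ×-configuration -/

section Gen

variable {R : Type*}

/-- GENERICITY of the ×-configuration `{a, q a | b, q b}` with ratio `q`: the four elements
`a, q a, b, q b` are pairwise distinct, and neither pair `{a, q b}`, `{q a, b}` (the eigenvalue pairs
of the two residual constituents in cross position) has internal ratio `q^{±1}` beyond the cases
already listed, i.e. `a ≠ q² b` and `b ≠ q² a` (`q² = 1` is allowed).  This is the residual
regularity hypothesis "`ρ̄(Frob_v)` takes two distinct eigenvalues `α_v, β_v` with `α_v/β_v = −1`"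
(`= q_v` in `k`) of Thorne's Steinberg deformation problem, transposed to two `GL₂`-constituents.
[cite: Thorne2016, §5.4.4] -/
def Gen [Monoid R] (q a b : R) : Prop :=
  a ≠ q * a ∧ a ≠ b ∧ a ≠ q * b ∧ q * a ≠ b ∧ q * a ≠ q * b ∧ b ≠ q * b ∧
    a ≠ q ^ 2 * b ∧ b ≠ q ^ 2 * a

/-- `Gen` is symmetric in the two constituents `a ↔ b`. [folklore] -/
theorem Gen.symm [Monoid R] {q a b : R} (h : Gen q a b) : Gen q b a := by
  obtain ⟨h1, h2, h3, h4, h5, h6, h7, h8⟩ := h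
  exact ⟨h6, h2.symm, h4.symm, h3.symm, h5.symm, h1, h8, h7⟩

/-- `Gen q a b ↔ Gen q b a`. [folklore] -/
theorem gen_comm [Monoid R] {q a b : R} : Gen q a b ↔ Gen q b a :=
  ⟨Gen.symm, Gen.symm⟩

/-- `Gen` says exactly: the list `[a, q a, b, q b]` is pairwise distinct, `a ≠ q² b` and `b ≠ q² a`.
[folklore] -/
theorem gen_iff_pairwise [Monoid R] {q a b : R} :
    Gen q a b ↔ [a, q * a, b, q * b].Pairwise (· ≠ ·) ∧ a ≠ q ^ 2 * b ∧ b ≠ q ^ 2 * a := by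
  simp [Gen, and_assoc]

/-- A generic ratio is not `1`. [folklore] -/
theorem Gen.ne_one [Monoid R] {q a b : R} (h : Gen q a b) : q ≠ 1 := by
  rintro rfl
  exact h.1 (one_mul a).symm

/-- The elements of a generic ×-configuration are non-zero. [folklore] -/
theorem Gen.ne_zero [MonoidWithZero R] {q a b : R} (h : Gen q a b) : a ≠ 0 ∧ b ≠ 0 := by
  constructor
  · rintro rfl
    exact h.1 (mul_zero q).symm
  · rintro rfl
    exact h.2.2.2.2.2.1 (mul_zero q).symm

end Gen

/-! ### The ×-polynomial -/

section CrossPoly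

variable {R S : Type*} [CommRing R] [CommRing S]

/-- The ×-POLYNOMIAL `(X − a)(X − q a)(X − b)(X − q b)`: the characteristic polynomial of a
×-configuration with ratio `q`. [folklore] -/
def crossPoly (q a b : R) : R[X] :=
  (X - C a) * (X - C (q * a)) * (X - C b) * (X - C (q * b))

/-- `crossPoly` commutes with ring homomorphisms (e.g. reduction `𝒪 → k`, inclusion `𝒪 → L`).
[folklore] -/
@[simp] theorem crossPoly_map (f : R →+* S) (q a b : R) :
    (crossPoly q a b).map f = crossPoly (f q) (f a) (f b) := by
  simp [crossPoly, Polynomial.map_mul, Polynomial.map_sub, map_mul]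

/-- The ×-polynomial is the product of the two CROSS quadratics `(X − a)(X − q b)` and
`(X − q a)(X − b)` — the Frobenius polynomials of the two residual constituents in `CrossRes`.
[folklore] -/
theorem crossPoly_eq_mul (q a b : R) :
    crossPoly q a b = ((X - C a) * (X - C (q * b))) * ((X - C (q * a)) * (X - C b)) := by
  unfold crossPoly
  ring

/-- `crossPoly` is symmetric in `a ↔ b`. [folklore] -/
theorem crossPoly_swap (q a b : R) : crossPoly q b a = crossPoly q a b := by
  unfold crossPoly
  ring

/-- `crossPoly` is monic (of degree `4`). [folklore] -/
theorem monic_crossPoly (q a b : R) : (crossPoly q a b).Monic :=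
  (((monic_X_sub_C a).mul (monic_X_sub_C _)).mul (monic_X_sub_C b)).mul (monic_X_sub_C _)

end CrossPoly

/-! ### Residual cross-regularity -/

section Residual

variable {K : Type*} [Field K] [NumberField K] {k : Type*} [CommRing k] [TopologicalSpace k]

/-- CROSS-REGULAR RESIDUAL FROBENIUS at `v` in the fixed cross position: the rank-2 representations
`σ`, `σ'` (the two residual constituents) have arithmetic-Frobenius characteristic polynomials
`(X − a)(X − q̄_v b)` and `(X − q̄_v a)(X − b)` at `v` (`q̄_v` the image of `q_v = v.residueCard` in
`k`), and the configuration is generic (`Gen q̄_v a b`).  So `σ ⊕ σ'` has the pairwise distinct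
Frobenius eigenvalues `{a, q̄_v a, b, q̄_v b}` with the two `q̄_v`-ratio pairs split ACROSS the
constituents — the two-constituent form of the regularity hypothesis under which Thorne's Steinberg
condition `𝒟_v^{St(α_v)}` is defined and sees only one summand of `ad⁰`.
[cite: Thorne2016, §5.4.4 and Lemma 5.18] -/
def CrossRes (σ σ' : FramedGaloisRep K k 2) (v : HeightOneSpectrum (𝓞 K)) (a b : k) : Prop :=
  σ.HasFrobCharpolyAt v ((X - C a) * (X - C ((v.residueCard : k) * b))) ∧
  σ'.HasFrobCharpolyAt v ((X - C ((v.residueCard : k) * a)) * (X - C b)) ∧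
  Gen (v.residueCard : k) a b

/-- `CrossRes` is symmetric under swapping the constituents together with `a ↔ b`. [folklore] -/
theorem CrossRes.symm {σ σ' : FramedGaloisRep K k 2} {v : HeightOneSpectrum (𝓞 K)} {a b : k}
    (h : CrossRes σ σ' v a b) : CrossRes σ' σ v b a := by
  obtain ⟨h1, h2, h3⟩ := h
  refine ⟨?_, ?_, h3.symm⟩
  · rw [mul_comm (X - C b)]
    exact h2
  · rw [mul_comm (X - C ((v.residueCard : k) * b))]
    exact h1

/-- The product of the two residual Frobenius polynomials of a cross-regular pair is the (residual)
×-polynomial `crossPoly q̄_v a b`. [folklore] -/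
theorem CrossRes.mul_eq_crossPoly {σ σ' : FramedGaloisRep K k 2} {v : HeightOneSpectrum (𝓞 K)}
    {a b : k} (_h : CrossRes σ σ' v a b) :
    ((X - C a) * (X - C ((v.residueCard : k) * b))) * ((X - C ((v.residueCard : k) * a)) * (X - C b)) =
      crossPoly (v.residueCard : k) a b :=
  (crossPoly_eq_mul _ a b).symm

end Residual

/-! ### ×-type of a characteristic-zero representation -/

section CrossType

variable {K : Type*} [Field K] [NumberField K] {L : Type*} [CommRing L] [TopologicalSpace L]

/-- ×-TYPE at `v` of a rank-4 representation `r` (coefficients `L`, typically `ℚ̄_p`): every inertia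
group above `v` acts through elements `u = r(τ)` with `(u − 1)² = 0` (unipotent, square-zero
monodromy; `u = 1` allowed), and every arithmetic Frobenius at `v` has characteristic polynomial
EXACTLY `crossPoly q_v a b = (X − a)(X − q_v a)(X − b)(X − q_v b)` for some `a b` with `q_v² a b = 1`
(two `q_v`-ratio pairs, paired with each other under `x ↦ q_v⁻¹ x⁻¹`).  The rank-4, two-block
transposition of Thorne's Steinberg local condition `𝒟_v^{St(α_v)}` (Frobenius eigenvalues
`{A_v, q_v A_v}`, inertia unipotent). [cite: Thorne2016, §5.4.4] -/
def CrossType (v : HeightOneSpectrum (𝓞 K)) (r : FramedGaloisRep K L 4) : Prop :=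
  (∀ 𝔓 ∈ v.primesAbove, ∀ τ ∈ 𝔓.inertia (absoluteGaloisGroup K),
      (((r τ : GL (Fin 4) L) : Matrix (Fin 4) (Fin 4) L) - 1) ^ 2 = 0) ∧
  ∃ a b : L, (v.residueCard : L) ^ 2 * a * b = 1 ∧
    r.HasFrobCharpolyAt v (crossPoly (v.residueCard : L) a b)

/-- An UNRAMIFIED representation whose Frobenius polynomial at `v` is a ×-polynomial
`crossPoly q_v a b` with `q_v² a b = 1` is of ×-type at `v` (the `u = 1` points of the condition).
[folklore] -/
theorem CrossType.of_isUnramifiedAt {v : HeightOneSpectrum (𝓞 K)} {r : FramedGaloisRep K L 4}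
    (hr : r.IsUnramifiedAt v) {a b : L} (hab : (v.residueCard : L) ^ 2 * a * b = 1)
    (h : r.HasFrobCharpolyAt v (crossPoly (v.residueCard : L) a b)) : CrossType v r := by
  refine ⟨fun 𝔓 h𝔓 τ hτ => ?_, a, b, hab, h⟩
  rw [hr 𝔓 h𝔓 τ hτ]
  simp

/-- A representation of ×-type at `v` has SOME Frobenius characteristic polynomial at `v`, which is a
×-polynomial. [folklore] -/
theorem CrossType.exists_hasFrobCharpolyAt {v : HeightOneSpectrum (𝓞 K)} {r : FramedGaloisRep K L 4}
    (h : CrossType v r) :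
    ∃ a b : L, (v.residueCard : L) ^ 2 * a * b = 1 ∧
      r.HasFrobCharpolyAt v (crossPoly (v.residueCard : L) a b) :=
  h.2

end CrossType

/-! ### Integral notions over `ℚ̄_p` : ×-congruence, exact cross-regular elements, Hecke span -/

section Integral

variable {K : Type*} [Field K] {p : ℕ} [Fact p.Prime] {k : Type*} [CommRing k] [TopologicalSpace k]

section CrossCongr

variable [NumberField K]

/-- ×-CONGRUENCE modulo `p^N` of `r(Frob_v)` (`r : Γ_K → GL₄(ℚ̄_p)`, `a b ∈ ℤ̄_p = 𝒪[ℚ̄_p]`): `r` has an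
INTEGRAL arithmetic-Frobenius characteristic polynomial `P ∈ ℤ̄_p[X]` at `v` which is congruent
coefficientwise modulo `p^N` to the ×-polynomial `crossPoly q_v a b = (X − a)(X − q_v a)(X − b)(X − q_v b)`,
where `q_v² a b = 1` holds EXACTLY.  In words (for `r` unramified at `v`, which is NOT part of this
predicate): `r mod p^N` is an unramified point of the ×-type condition at `v` — the analogue of
"`ρ_{N}(Frob_v) = ρ_{N}(c)`" at Thorne's auxiliary places `v ∈ Q₀`. [cite: Thorne2016, Prop. 5.20] -/
def CrossCongr (N : ℕ) (v : HeightOneSpectrum (𝓞 K)) (r : FramedGaloisRep K (PadicAlgCl p) 4)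
    (a b : 𝒪[PadicAlgCl p]) : Prop :=
  ∃ P : (𝒪[PadicAlgCl p])[X],
    r.HasFrobCharpolyAt v (P.map (Valued.integer (PadicAlgCl p)).subtype) ∧
    (v.residueCard : 𝒪[PadicAlgCl p]) ^ 2 * a * b = 1 ∧
    ∀ j : ℕ, (p : 𝒪[PadicAlgCl p]) ^ N ∣
      (P - crossPoly (v.residueCard : 𝒪[PadicAlgCl p]) a b).coeff j

/-- ×-congruence modulo `p^N` implies ×-congruence modulo `p^M` for `M ≤ N`. [folklore] -/
theorem CrossCongr.mono {M N : ℕ} (hMN : M ≤ N) {v : HeightOneSpectrum (𝓞 K)}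
    {r : FramedGaloisRep K (PadicAlgCl p) 4} {a b : 𝒪[PadicAlgCl p]} (h : CrossCongr N v r a b) :
    CrossCongr M v r a b := by
  obtain ⟨P, hP, hab, hdvd⟩ := h
  exact ⟨P, hP, hab, fun j => (pow_dvd_pow _ hMN).trans (hdvd j)⟩

/-- A representation whose Frobenius polynomial at `v` is EXACTLY an integral ×-polynomial with
`q_v² a b = 1` is ×-congruent at every depth `N`. [folklore] -/
theorem CrossCongr.of_hasFrobCharpolyAt (N : ℕ) {v : HeightOneSpectrum (𝓞 K)}
    {r : FramedGaloisRep K (PadicAlgCl p) 4} {a b : 𝒪[PadicAlgCl p]}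
    (hab : (v.residueCard : 𝒪[PadicAlgCl p]) ^ 2 * a * b = 1)
    (h : r.HasFrobCharpolyAt v
      ((crossPoly (v.residueCard : 𝒪[PadicAlgCl p]) a b).map (Valued.integer (PadicAlgCl p)).subtype)) :
    CrossCongr N v r a b :=
  ⟨_, h, hab, fun j => by simp⟩

end CrossCongr

/-- EXACT CROSS-REGULAR ELEMENT in the image of `ρ : Γ_K → GL₄(ℚ̄_p)` relative to the residual pair
`(σ, σ')` and the reduction map `red : ℤ̄_p → k`: some `γ ∈ Γ_K` and `a b e ∈ ℤ̄_p` with `e = ε_p(γ)`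
(the `p`-adic cyclotomic character, pushed along `ℤ_p → ℚ_p → ℚ̄_p`), `e² a b = 1`,
`charpoly ρ(γ) = (X − a)(X − e a)(X − b)(X − e b) = crossPoly e a b`, in CROSS POSITION residually —
`charpoly σ(γ) = (X − ā)(X − ē b̄)`, `charpoly σ'(γ) = (X − ē ā)(X − b̄)` — and residually generic
(`Gen ē ā b̄`).  This element plays the role of Thorne's fixed `c` with `ρ_N(Frob_v) = ρ_N(c)` at the
auxiliary places; at `γ = Frob_v` one has `e = q_v`, recovering `CrossCongr`/`CrossRes`.
[cite: Thorne2016, Prop. 5.20] -/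
def ExactCross (σ σ' : FramedGaloisRep K k 2) (red : 𝒪[PadicAlgCl p] →+* k)
    (ρ : FramedGaloisRep K (PadicAlgCl p) 4) : Prop :=
  ∃ (γ : absoluteGaloisGroup K) (a b e : 𝒪[PadicAlgCl p]),
    (e : PadicAlgCl p) = algebraMap ℚ_[p] (PadicAlgCl p)
      (((GaloisRep.cyclotomicCharacter K p γ : ℤ_[p]ˣ) : ℤ_[p]) : ℚ_[p]) ∧
    e ^ 2 * a * b = 1 ∧
    FramedRep.charpoly ρ γ = crossPoly (e : PadicAlgCl p) (a : PadicAlgCl p) (b : PadicAlgCl p) ∧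
    FramedRep.charpoly σ γ = (X - C (red a)) * (X - C (red e * red b)) ∧
    FramedRep.charpoly σ' γ = (X - C (red e * red a)) * (X - C (red b)) ∧
    Gen (red e) (red a) (red b)

/-- Change of frame does not change characteristic polynomials (Mathlib `Matrix.charpoly_units_conj`;
local copy, to keep the import cone of this file small). [folklore] -/
private theorem charpoly_conj_aux {G : Type*} [Group G] [TopologicalSpace G] {A : Type*} [CommRing A]
    [TopologicalSpace A] [IsTopologicalRing A] {n : ℕ} (P : GL (Fin n) A) (ρ : FramedRep G A n)
    (g : G) : (ρ.conj P).charpoly g = ρ.charpoly g := by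
  simp only [FramedRep.charpoly, FramedRep.conj_apply, Units.val_mul, Matrix.coe_units_inv]
  exact Matrix.charpoly_units_conj P _

/-- `ExactCross` depends on `ρ` only up to a change of frame (`FramedRep.conj`). [folklore] -/
@[simp] theorem exactCross_conj_iff (σ σ' : FramedGaloisRep K k 2) (red : 𝒪[PadicAlgCl p] →+* k)
    (P : GL (Fin 4) (PadicAlgCl p)) (ρ : FramedGaloisRep K (PadicAlgCl p) 4) :
    ExactCross σ σ' red (ρ.conj P) ↔ ExactCross σ σ' red ρ := by
  simp only [ExactCross, charpoly_conj_aux]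

/-- `ExactCross` depends on the residual pair only up to changes of frame. [folklore] -/
@[simp] theorem exactCross_conj_conj_iff [IsTopologicalRing k] (P P' : GL (Fin 2) k)
    (σ σ' : FramedGaloisRep K k 2) (red : 𝒪[PadicAlgCl p] →+* k)
    (ρ : FramedGaloisRep K (PadicAlgCl p) 4) :
    ExactCross (σ.conj P) (σ'.conj P') red ρ ↔ ExactCross σ σ' red ρ := by
  simp only [ExactCross, charpoly_conj_aux]

variable {ι : Type*} {n : ℕ}

/-- HECKE-SPAN CONGRUENCE modulo `p^N` of `ϱ` to the family `(ρf i)_{i ∈ ι}` (all `Γ_K → GL_n(ℚ̄_p)`):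
away from a finite set `S` of places, every `ρf i` and `ϱ` are unramified with INTEGRAL Frobenius
polynomials `Pf i v, Pr v ∈ ℤ̄_p[X]`, and every `ℤ̄_p`-polynomial relation `F` in the variables
`(v, j)` (`v ∉ S`, `j` a coefficient index) satisfied by all the coefficient tuples
`((Pf i v)_j)_{v,j}` is satisfied by `((Pr v)_j)_{v,j}` modulo `p^N`.  Equivalently: the
`ℤ̄_p`-subalgebra `𝕋 ⊆ ∏_i ℤ̄_p` generated by the Frobenius-coefficient tuples (the anaemic Hecke
algebra of the family, acting faithfully) admits a homomorphism `𝕋 → ℤ̄_p/p^N` sending each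
generator to the corresponding coefficient of `ϱ` — the Hecke-algebra-free form of Thorne's datum
"`f : 𝕋 → 𝒪/λ^N` with `f(T_v) = tr ρ(Frob_v)` for `v ∉ S ∪ Q`".
[cite: Thorne2016, Thm. 4.14 and Cor. 4.15] -/
def HSC (N : ℕ) (ρf : ι → FramedGaloisRep K (PadicAlgCl p) n) (ϱ : FramedGaloisRep K (PadicAlgCl p) n) :
    Prop :=
  ∃ S : Set (HeightOneSpectrum (𝓞 K)), S.Finite ∧
    ∃ (Pf : ι → HeightOneSpectrum (𝓞 K) → (𝒪[PadicAlgCl p])[X])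
      (Pr : HeightOneSpectrum (𝓞 K) → (𝒪[PadicAlgCl p])[X]),
      (∀ i, ∀ v ∉ S, (ρf i).IsUnramifiedAt v ∧
        (ρf i).HasFrobCharpolyAt v ((Pf i v).map (Valued.integer (PadicAlgCl p)).subtype)) ∧
      (∀ v ∉ S, ϱ.IsUnramifiedAt v ∧
        ϱ.HasFrobCharpolyAt v ((Pr v).map (Valued.integer (PadicAlgCl p)).subtype)) ∧
      ∀ F : MvPolynomial (HeightOneSpectrum (𝓞 K) × ℕ) (𝒪[PadicAlgCl p]),
        (∀ x ∈ F.vars, x.1 ∉ S) →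
        (∀ i, MvPolynomial.eval (fun x => (Pf i x.1).coeff x.2) F = 0) →
          (p : 𝒪[PadicAlgCl p]) ^ N ∣ MvPolynomial.eval (fun x => (Pr x.1).coeff x.2) F

/-- Hecke-span congruence modulo `p^N` implies it modulo `p^M` for `M ≤ N`. [folklore] -/
theorem HSC.mono {M N : ℕ} (hMN : M ≤ N) {ρf : ι → FramedGaloisRep K (PadicAlgCl p) n}
    {ϱ : FramedGaloisRep K (PadicAlgCl p) n} (h : HSC N ρf ϱ) : HSC M ρf ϱ := by
  obtain ⟨S, hS, Pf, Pr, hf, hr, hrel⟩ := h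
  exact ⟨S, hS, Pf, Pr, hf, hr, fun F hF h0 => (pow_dvd_pow _ hMN).trans (hrel F hF h0)⟩

/-- Non-vacuity: a MEMBER `ρf i₀` of a family which is unramified with integral Frobenius polynomials
outside a common finite set `S` is Hecke-span congruent to the family at every depth `N`. [folklore] -/
theorem HSC.of_mem {S : Set (HeightOneSpectrum (𝓞 K))} (hS : S.Finite)
    {ρf : ι → FramedGaloisRep K (PadicAlgCl p) n}
    (h : ∀ i, ∀ v ∉ S, (ρf i).IsUnramifiedAt v ∧ ∃ P : (𝒪[PadicAlgCl p])[X],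
      (ρf i).HasFrobCharpolyAt v (P.map (Valued.integer (PadicAlgCl p)).subtype))
    (i₀ : ι) (N : ℕ) : HSC N ρf (ρf i₀) := by
  classical
  have h' : ∀ i (v : HeightOneSpectrum (𝓞 K)), ∃ P : (𝒪[PadicAlgCl p])[X], v ∉ S →
      (ρf i).HasFrobCharpolyAt v (P.map (Valued.integer (PadicAlgCl p)).subtype) := fun i v => by
    by_cases hv : v ∈ S
    · exact ⟨0, fun h => (h hv).elim⟩
    · obtain ⟨P, hP⟩ := (h i v hv).2
      exact ⟨P, fun _ => hP⟩
  choose Pf hPf using h'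
  refine ⟨S, hS, Pf, Pf i₀, fun i v hv => ⟨(h i v hv).1, hPf i v hv⟩,
    fun v hv => ⟨(h i₀ v hv).1, hPf i₀ v hv⟩, fun F _ hrel => ?_⟩
  rw [hrel i₀]
  exact dvd_zero _

end Integral

end CrossRegular

end Literature.NumberTheory.GaloisRepresentations

end
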